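import Literature.NumberTheory.EllipticCurves.LocalPointsIntegersSubgroup
import HarnessLib

/-!
# The witness road's LOCAL CERTIFICATE: `p`-divisibility of a `K`-rational point in `E(K_v)` from
# the formal group (team n1011, row T-VIS3-WC FILE 1; seat p09 GEN 10)

HONEST FRAMING (cell `b2b-bsdres`, run/shared/lean/b2b/bsd-rank1-residual/, verbatim in every
file): the goal of the cell is to DELETE the COMBINATION-SHAPED residual classes of the
Birch–Swinnerton-Dyer formula for ALL analytic-rank `≤ 1` elliptic curves over `ℚ` — "full BSD
formula for every rank `≤ 1` curve in class `C`" assembled STRICTLY from published theorems — so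
that the rank-`≤ 1` remainder becomes exactly the CONSTRUCTION-SHAPED classes, which are TYPED
(missing-input `Prop`s), NOT attempted. This is not "finishing BSD". Team n1011 (N10/N11 = X4 ∧
`p = 3`, research route; ROW T-VIS3-WC = the kernel half of r1 ROUTE-1 §41.9 road F3:W, "a kernel
3-division certificate per pair" for the witness theorem of `GaloisImage/CongruenceVisibilityWitness`).
THIS FILE IS A TOOL: theorems only (no definition, no named fact, no `sorry`); it closes nothing,
books nothing, moves no mark / label / count.

## What and why

The explicit-witness visibility theorem
`VisibleWitness.exists_sha_ne_zero_of_congr_of_locallyDivisible` (`CongruenceVisibilityWitness.lean`)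
asks, at every place `v` of the finite set `S`, EITHER for a `p`-th root of the witness point in
`E'(K_v)` — `∃ Q : E'(K_v), p • Q = P|_{K_v}` — OR for `v ∤ p ∧ #E'(K_v)[p] = 1` (n1011-p18's kernel
column). This file produces the FIRST disjunct from two valuations of the coordinates of
`P = (x, y) ∈ E'(K)`, by the formal group (Silverman, *AEC* IV.6.4(b), VII.2.2, in the chart language
of the tree's `FormalGroupChart` / `FormalGroupDivision` / `LocalPointsIntegersSubgroup` — no power
series):

* §1 (`v ∣ p`) `exists_nsmul_eq_of_mem_kernel_of_val_zCoord_le_cube` — a point `T` of the kernel of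
  reduction `E₁(K_v)` of a `v`-integral equation with `|z(T)|_v ≤ |p|_v³` (`z = -x/y`) is `p • Q`
  (`Q ∈ E₁(K_v)`, `|z(Q)|_v ≤ |p|_v²`): the tree's successive-approximation division
  `FormalGroupChart.exists_nsmul_eq_of_val_le_mul` (`N = p`, `c = |p|`, `ρ = |p|²`) fed with the Hensel
  lift `LocalPoints.hlift` and the completeness `LocalPoints.exists_limit_of_geometric`; stated for an
  `O_v`-model and (primed) for ANY `v`-integral `V/K_v` (Mathlib `IsIntegral` for the valuation ring);
* §2 (`v ∤ p`) `exists_nsmul_eq_of_mem_kernel_of_not_mem` — EVERY `T ∈ E₁(K_v)` is `p • Q`: `|p|_v = 1`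
  and the same lemma with `ρ = |z(T)|_v < 1` (the formal group is uniquely `p`-divisible away from `p`);
* §3 plumbing for rational points: `zCoord_baseChange` (`z(P|_L) = ι z(P)`),
  `baseChange_some_mem_kernel_iff` (`(x, y)|_{K_v} ∈ E₁ ↔ 1 < |ι x|_v`),
  `isIntegral_baseChange_adicCompletion_of_integers` (the `IsIntegral` instance of `(W₁ ⊗ K) ⊗ K_v`
  for `W₁` over `𝓞 K`, Mathlib `NumberField.FinitePlace.norm_le_one`);
* §4 ENDs = literally the first disjunct of `hdiv`, for `P = .some x y h ∈ E'(K)` on a `K`-equation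
  whose base change to `K_v` is elliptic and `v`-integral:
  `exists_nsmul_eq_baseChange_of_one_lt_val_of_val_le` (`v ∣ p`: `1 < |ι x|_v`, `|ι(x/y)|_v ≤ |p|_v³`),
  `exists_nsmul_eq_baseChange_of_one_lt_val` (`v ∤ p`: `1 < |ι x|_v`), and the uniform
  `exists_nsmul_eq_baseChange_of_one_lt_val_of_imp` (depth asked only when `p ∈ v`).

HONEST PRICE. A SUFFICIENT criterion: at `v ∣ p` with `p` odd and `e(v/p) = 1` the truth is
`E₁ ∩ p E(K_v) ⊇ {|z| ≤ |p|²}` (AEC IV.6.4(b)); the tree's division lemma costs one more factor `|p|`.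
No group law is evaluated in the kernel: the witness theorem needs only SOME point of the class
`P + pE'(K)` (times a unit mod `p`), so a record presents a representative `T = m·P - p·R`
(`p ∤ m`, `R ∈ E'(K)`, found outside the kernel) whose coordinates pass the two tests; whether such a
representative exists for a given pair is a census question (r1), not settled here. The companion
FILE 2 (`FormalGroupLocalDivisibilityRat`) reads the two tests over `ℚ` from `padicValRat` /
denominators. NOT claimed: necessity, any `3`-adic decision (r1's engine, EVIDENCE), `θ`, ranks,
`P ∉ pE'(K)`, anything in the `Visible*` files (consumed BY NAME only).

## References (provenance of the method; nothing is cited as a fact)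

* [SilvermanAEC2009] J. H. Silverman, *The Arithmetic of Elliptic Curves*, 2nd ed., GTM 106:
  Thm. IV.6.4(b) (`[p] : Ê(𝓜ʳ) → Ê(𝓜ʳ⁺ᵛ⁽ᵖ⁾)`-type statements via the formal logarithm), Prop. VII.2.2
  (`E₁(K) ≅ Ê(𝓜)`), Prop. VII.2.1.

## Design

`noncomputable section`, `open scoped Classical NNReal`; theorems only; the analytic inputs are
the tree's (`hlift`, `exists_limit_of_geometric`), not restated. Axioms: `propext`,
`Classical.choice`, `Quot.sound`.
-/

noncomputable section

open scoped Classical NNReal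

namespace Summit.BirchSwinnertonDyer.Rank1Residual.GaloisImage.LocalDivisibility

open Literature.NumberTheory.EllipticCurves Literature.NumberTheory.EllipticCurves.LocalPoints
open Literature.NumberTheory.EllipticCurves.FormalGroupChart NumberField IsDedekindDomain

universe u

variable {K : Type u} [Field K] [NumberField K] (v : HeightOneSpectrum (𝓞 K))

/-! ### §1. `v ∣ p`: division by `p` deep in the formal group over `K_v` -/

/-- **Division by `p` deep in the formal group over `K_v` (`v ∣ p`).** Let `W₀` be a Weierstrass
equation over `O_v` with `W₀ ⊗ K_v` elliptic, `p` a prime with `p ∈ v`. Every `T ∈ E₁(K_v)` (the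
kernel of reduction, `FormalGroupChart.kernel`) with `|z(T)| ≤ |p|³` (`z = -x/y`) is `p • Q` for some
`Q ∈ E₁(K_v)` with `|z(Q)| ≤ |p|²`: the tree's successive-approximation division
`FormalGroupChart.exists_nsmul_eq_of_val_le_mul` (`N = p`, `c = |p|`, `ρ = |p|² < c`) with the Hensel
lift `LocalPoints.hlift` and the completeness `LocalPoints.exists_limit_of_geometric`
(Silverman, *AEC* IV.6.4(b) / VII.2.2; for `p` odd and `e(v/p) = 1` the sharp statement is
`E₂ = p E₁`, the chart version here gives `E₃ ⊆ p E₂`). [cite: SilvermanAEC2009, Thm. IV.6.4]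
[cite: SilvermanAEC2009, Prop. VII.2.2] -/
theorem exists_nsmul_eq_of_mem_kernel_of_val_zCoord_le_cube
    (W₀ : WeierstrassCurve (v.adicCompletionIntegers K))
    [(W₀.baseChange (v.adicCompletion K)).IsElliptic]
    [(W₀.baseChange (v.adicCompletion K)).IsIntegral
      ((NormedField.valuation : Valuation (v.adicCompletion K) ℝ≥0)).integer]
    {p : ℕ} (hp : p.Prime)
    (hpv : (p : 𝓞 K) ∈ v.asIdeal) {T : (W₀.baseChange (v.adicCompletion K)).toAffine.Point}
    (hT : T ∈ kernel (NormedField.valuation : Valuation (v.adicCompletion K) ℝ≥0)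
      (W₀.baseChange (v.adicCompletion K)))
    (hTz : (NormedField.valuation : Valuation (v.adicCompletion K) ℝ≥0) T.zCoord ≤
      (NormedField.valuation : Valuation (v.adicCompletion K) ℝ≥0) (p : v.adicCompletion K) ^ 3) :
    ∃ Q ∈ kernel (NormedField.valuation : Valuation (v.adicCompletion K) ℝ≥0)
        (W₀.baseChange (v.adicCompletion K)),
      (NormedField.valuation : Valuation (v.adicCompletion K) ℝ≥0) Q.zCoord ≤
          (NormedField.valuation : Valuation (v.adicCompletion K) ℝ≥0) (p : v.adicCompletion K) ^ 2 ∧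
        p • Q = T := by
  haveI : CharZero (v.adicCompletion K) :=
    charZero_of_injective_algebraMap (algebraMap K _).injective
  set c : ℝ≥0 := (NormedField.valuation : Valuation (v.adicCompletion K) ℝ≥0)
    (p : v.adicCompletion K) with hc
  have hp0 : (p : (v.adicCompletion K)) ≠ 0 := Nat.cast_ne_zero.mpr hp.ne_zero
  have hc0 : 0 < c := (Valuation.pos_iff _).mpr hp0
  have hc1 : c < 1 := valuation_natCast_lt_one v hpv
  have hρc : c ^ 2 < c := by
    calc c ^ 2 = c * c := sq c
      _ < 1 * c := mul_lt_mul_of_pos_right hc1 hc0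
      _ = c := one_mul c
  have hρ1 : c ^ 2 < 1 := hρc.trans hc1
  have hTz' : (NormedField.valuation : Valuation (v.adicCompletion K) ℝ≥0) T.zCoord ≤ c * c ^ 2 := by
    calc _ ≤ c ^ 3 := hTz
      _ = c * c ^ 2 := by ring
  exact exists_nsmul_eq_of_val_le_mul (w := (NormedField.valuation : Valuation (v.adicCompletion K) ℝ≥0))
    (V := W₀.baseChange (v.adicCompletion K)) (N := p) rfl hc0 hρc (hlift v W₀ hρ1)
    (exists_limit_of_geometric v) hT hTz'

/-- An `O_v`-model of a `v`-integral equation `V/K_v` (Mathlib `IsIntegral` for the valuation ring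
of the norm valuation): some `W₀` over `O_v` with `W₀ ⊗ K_v = V`. [folklore] -/
theorem exists_baseChange_eq_of_isIntegral (V : WeierstrassCurve (v.adicCompletion K))
    [hint : V.IsIntegral ((NormedField.valuation : Valuation (v.adicCompletion K) ℝ≥0)).integer] :
    ∃ W₀ : WeierstrassCurve (v.adicCompletionIntegers K), W₀.baseChange (v.adicCompletion K) = V := by
  obtain ⟨W₁, hW₁⟩ := hint.integral
  have hmem : ∀ a : ((NormedField.valuation : Valuation (v.adicCompletion K) ℝ≥0)).integer,
      (a : v.adicCompletion K) ∈ v.adicCompletionIntegers K := fun a ↦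
    (norm_le_one_iff_mem v (a : v.adicCompletion K)).mp (by
      have h : (NormedField.valuation : Valuation (v.adicCompletion K) ℝ≥0)
          (a : v.adicCompletion K) ≤ 1 := a.2
      rwa [valuation_apply, ← NNReal.coe_le_coe, coe_nnnorm, NNReal.coe_one] at h)
  refine ⟨⟨⟨_, hmem W₁.a₁⟩, ⟨_, hmem W₁.a₂⟩, ⟨_, hmem W₁.a₃⟩, ⟨_, hmem W₁.a₄⟩, ⟨_, hmem W₁.a₆⟩⟩, ?_⟩
  rw [hW₁]; rfl

/-- **The same for ANY `v`-integral elliptic Weierstrass equation `V` over `K_v`** (Mathlib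
`IsIntegral` w.r.t. the valuation ring of `K_v`; e.g. `V = W ⊗ K_v` for a `K`-model `W` whose
coefficients are `v`-integral), `p ∈ v`: a point `T ∈ E₁(K_v)` with `|z(T)| ≤ |p|³` is `p • Q`,
`Q ∈ E₁(K_v)`, `|z(Q)| ≤ |p|²`. The `O_v`-model needed by the Hensel lift is rebuilt from the
`IsIntegral` witness (`exists_baseChange_eq_of_isIntegral`). [cite: SilvermanAEC2009, Thm. IV.6.4]
[cite: SilvermanAEC2009, Prop. VII.2.2] -/
theorem exists_nsmul_eq_of_mem_kernel_of_val_zCoord_le_cube'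
    (V : WeierstrassCurve (v.adicCompletion K)) [V.IsElliptic]
    [V.IsIntegral ((NormedField.valuation : Valuation (v.adicCompletion K) ℝ≥0)).integer]
    {p : ℕ} (hp : p.Prime) (hpv : (p : 𝓞 K) ∈ v.asIdeal) {T : V.toAffine.Point}
    (hT : T ∈ kernel (NormedField.valuation : Valuation (v.adicCompletion K) ℝ≥0) V)
    (hTz : (NormedField.valuation : Valuation (v.adicCompletion K) ℝ≥0) T.zCoord ≤
      (NormedField.valuation : Valuation (v.adicCompletion K) ℝ≥0) (p : v.adicCompletion K) ^ 3) :
    ∃ Q ∈ kernel (NormedField.valuation : Valuation (v.adicCompletion K) ℝ≥0) V,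
      (NormedField.valuation : Valuation (v.adicCompletion K) ℝ≥0) Q.zCoord ≤
          (NormedField.valuation : Valuation (v.adicCompletion K) ℝ≥0) (p : v.adicCompletion K) ^ 2 ∧
        p • Q = T := by
  obtain ⟨W₀, hW₀⟩ := exists_baseChange_eq_of_isIntegral v V
  subst hW₀
  exact exists_nsmul_eq_of_mem_kernel_of_val_zCoord_le_cube v W₀ hp hpv hT hTz

/-! ### §2. `v ∤ p`: the formal group is `p`-divisible away from `p` -/

/-- **Division by `p` in the formal group over `K_v` AWAY from `p` (`v ∤ p`).** Let `W₀` be a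
Weierstrass equation over `O_v` with `W₀ ⊗ K_v` elliptic and `p` a natural number with `p ∉ v`, so that
`|p|_v = 1`. EVERY `T ∈ E₁(K_v)` is `p • Q` for some `Q ∈ E₁(K_v)` with `|z(Q)| ≤ |z(T)|`: the tree's
`FormalGroupChart.exists_nsmul_eq_of_val_le_mul` with `c = |p| = 1` and `ρ = |z(T)| < 1`
(`val_zCoord_lt_one`). (Silverman, *AEC* IV.2.3 / IV.3.2(b): `[m]` is an isomorphism of `Ê(𝓜)` for
`m` prime to the residue characteristic; VII.2.2.) [cite: SilvermanAEC2009, Thm. IV.6.4]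
[cite: SilvermanAEC2009, Prop. VII.2.2] -/
theorem exists_nsmul_eq_of_mem_kernel_of_not_mem
    (W₀ : WeierstrassCurve (v.adicCompletionIntegers K))
    [(W₀.baseChange (v.adicCompletion K)).IsElliptic]
    [(W₀.baseChange (v.adicCompletion K)).IsIntegral
      ((NormedField.valuation : Valuation (v.adicCompletion K) ℝ≥0)).integer]
    {p : ℕ} (hpv : (p : 𝓞 K) ∉ v.asIdeal) {T : (W₀.baseChange (v.adicCompletion K)).toAffine.Point}
    (hT : T ∈ kernel (NormedField.valuation : Valuation (v.adicCompletion K) ℝ≥0)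
      (W₀.baseChange (v.adicCompletion K))) :
    ∃ Q ∈ kernel (NormedField.valuation : Valuation (v.adicCompletion K) ℝ≥0)
        (W₀.baseChange (v.adicCompletion K)),
      (NormedField.valuation : Valuation (v.adicCompletion K) ℝ≥0) Q.zCoord ≤
          (NormedField.valuation : Valuation (v.adicCompletion K) ℝ≥0) T.zCoord ∧
        p • Q = T := by
  haveI : CharZero (v.adicCompletion K) :=
    charZero_of_injective_algebraMap (algebraMap K _).injective
  set ρ : ℝ≥0 := (NormedField.valuation : Valuation (v.adicCompletion K) ℝ≥0) T.zCoord with hρ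
  have hc : (NormedField.valuation : Valuation (v.adicCompletion K) ℝ≥0)
      ((p : ℕ) : v.adicCompletion K) = 1 := valuation_natCast_eq_one v hpv
  have hρ1 : ρ < 1 := val_zCoord_lt_one hT
  have hTz : (NormedField.valuation : Valuation (v.adicCompletion K) ℝ≥0) T.zCoord ≤ 1 * ρ := by
    rw [one_mul]
  exact exists_nsmul_eq_of_val_le_mul (w := (NormedField.valuation : Valuation (v.adicCompletion K) ℝ≥0))
    (V := W₀.baseChange (v.adicCompletion K)) (N := p) hc zero_lt_one hρ1 (hlift v W₀ hρ1)
    (exists_limit_of_geometric v) hT hTz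

/-- **The same for ANY `v`-integral elliptic `V/K_v`, `v ∤ p`**: every `T ∈ E₁(K_v)` is `p • Q` with
`Q ∈ E₁(K_v)`, `|z(Q)| ≤ |z(T)|`. [cite: SilvermanAEC2009, Thm. IV.6.4]
[cite: SilvermanAEC2009, Prop. VII.2.2] -/
theorem exists_nsmul_eq_of_mem_kernel_of_not_mem'
    (V : WeierstrassCurve (v.adicCompletion K)) [V.IsElliptic]
    [V.IsIntegral ((NormedField.valuation : Valuation (v.adicCompletion K) ℝ≥0)).integer]
    {p : ℕ} (hpv : (p : 𝓞 K) ∉ v.asIdeal) {T : V.toAffine.Point}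
    (hT : T ∈ kernel (NormedField.valuation : Valuation (v.adicCompletion K) ℝ≥0) V) :
    ∃ Q ∈ kernel (NormedField.valuation : Valuation (v.adicCompletion K) ℝ≥0) V,
      (NormedField.valuation : Valuation (v.adicCompletion K) ℝ≥0) Q.zCoord ≤
          (NormedField.valuation : Valuation (v.adicCompletion K) ℝ≥0) T.zCoord ∧
        p • Q = T := by
  obtain ⟨W₀, hW₀⟩ := exists_baseChange_eq_of_isIntegral v V
  subst hW₀
  exact exists_nsmul_eq_of_mem_kernel_of_not_mem v W₀ hpv hT

/-! ### §3. Plumbing for rational points: `z` and `x` of `P|_L`, integrality of global models -/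

omit [NumberField K] in
/-- `z(P|_L) = ι(z(P))` for the base change of a `K`-rational point along `ι : K → L`. [folklore] -/
theorem zCoord_baseChange {L : Type*} [Field L] [Algebra K L] (W : WeierstrassCurve K)
    (P : W.toAffine.Point) :
    (WeierstrassCurve.Affine.Point.baseChange (W' := W) K L P).zCoord = algebraMap K L P.zCoord := by
  rcases P with _ | ⟨x, y, h⟩
  · change (0 : (W.baseChange L).toAffine.Point).zCoord = algebraMap K L 0
    rw [WeierstrassCurve.Affine.Point.zCoord_zero, map_zero]
  · change (WeierstrassCurve.Affine.Point.map (W' := W) (Algebra.ofId K L)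
        (.some x y h)).zCoord = _
    rw [WeierstrassCurve.Affine.Point.map_some, WeierstrassCurve.Affine.Point.zCoord_some,
      WeierstrassCurve.Affine.Point.zCoord_some, map_div₀, map_neg]
    rfl

/-- The base change of an affine `K`-point `(x, y)` lies in the kernel of reduction `E₁(K_v)` of a
`v`-integral equation iff `|x|_v > 1` (`some_mem_kernel_iff`). [folklore] -/
theorem baseChange_some_mem_kernel_iff (W : WeierstrassCurve K)
    [(W.baseChange (v.adicCompletion K)).IsIntegral
      ((NormedField.valuation : Valuation (v.adicCompletion K) ℝ≥0)).integer]
    {x y : K} (h : W.toAffine.Nonsingular x y) :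
    WeierstrassCurve.Affine.Point.baseChange (W' := W) K (v.adicCompletion K) (.some x y h) ∈
        kernel (NormedField.valuation : Valuation (v.adicCompletion K) ℝ≥0)
          (W.baseChange (v.adicCompletion K)) ↔
      1 < (NormedField.valuation : Valuation (v.adicCompletion K) ℝ≥0)
        (algebraMap K (v.adicCompletion K) x) := by
  change WeierstrassCurve.Affine.Point.map (W' := W) (Algebra.ofId K (v.adicCompletion K))
      (.some x y h) ∈ _ ↔ _
  rw [WeierstrassCurve.Affine.Point.map_some]
  exact some_mem_kernel_iff _

/-- **The `IsIntegral` instance for a global integral model**: for `W₁` over `𝓞 K`, the base change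
of `W₁ ⊗ K` to `K_v` is integral for the valuation ring of `K_v` (every algebraic integer has
`|a|_v ≤ 1`, Mathlib `NumberField.FinitePlace.norm_le_one`). Feeds the instance argument of the §4
ENDs. [folklore] -/
theorem isIntegral_baseChange_adicCompletion_of_integers (W₁ : WeierstrassCurve (𝓞 K)) :
    ((W₁.baseChange K).baseChange (v.adicCompletion K)).IsIntegral
      ((NormedField.valuation : Valuation (v.adicCompletion K) ℝ≥0)).integer := by
  have hle : ∀ a : 𝓞 K, algebraMap K (v.adicCompletion K) (a : K) ∈
      ((NormedField.valuation : Valuation (v.adicCompletion K) ℝ≥0)).integer := fun a ↦ by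
    rw [Valuation.mem_integer_iff, valuation_apply, ← NNReal.coe_le_coe, coe_nnnorm, NNReal.coe_one]
    have h := NumberField.FinitePlace.norm_le_one K v a
    rw [NumberField.FinitePlace.embedding_apply] at h
    exact h
  exact WeierstrassCurve.isIntegral_of_exists_lift _ ⟨⟨_, hle W₁.a₁⟩, rfl⟩ ⟨⟨_, hle W₁.a₂⟩, rfl⟩
    ⟨⟨_, hle W₁.a₃⟩, rfl⟩ ⟨⟨_, hle W₁.a₄⟩, rfl⟩ ⟨⟨_, hle W₁.a₆⟩, rfl⟩

/-! ### §4. ENDs: the first disjunct of `hdiv` for a `K`-rational point -/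

/-- **END (`v ∣ p`): divisibility of a `K`-rational point by `p` in `E(K_v)` from two valuations** —
the input `∃ Q, p • Q = P|_{K_v}` of criterion (a) of `GaloisImage/CongruenceVisibilityWitness.lean`
(`exists_sha_ne_zero_of_congr_of_locallyDivisible`). Let `W` be a Weierstrass equation over `K`
whose base change to `K_v` is elliptic and `v`-integral, `p ∈ v`, and `P = (x, y) ∈ E(K)` with
`|x|_v > 1` and `|x/y|_v ≤ |p|_v³`. Then `P|_{K_v} = p • Q` for some `Q ∈ E(K_v)`. Over `ℚ` at
`v = (p)` for a `p`-integral model: `v_p(x) < 0` and `v_p(x/y) ≥ 3`.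
[cite: SilvermanAEC2009, Thm. IV.6.4] [cite: SilvermanAEC2009, Prop. VII.2.2] -/
theorem exists_nsmul_eq_baseChange_of_one_lt_val_of_val_le (W : WeierstrassCurve K)
    [(W.baseChange (v.adicCompletion K)).IsElliptic]
    [(W.baseChange (v.adicCompletion K)).IsIntegral
      ((NormedField.valuation : Valuation (v.adicCompletion K) ℝ≥0)).integer]
    {p : ℕ} (hp : p.Prime) (hpv : (p : 𝓞 K) ∈ v.asIdeal) {x y : K} (h : W.toAffine.Nonsingular x y)
    (hx : 1 < (NormedField.valuation : Valuation (v.adicCompletion K) ℝ≥0)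
      (algebraMap K (v.adicCompletion K) x))
    (hz : (NormedField.valuation : Valuation (v.adicCompletion K) ℝ≥0)
        (algebraMap K (v.adicCompletion K) (x / y)) ≤
      (NormedField.valuation : Valuation (v.adicCompletion K) ℝ≥0) (p : v.adicCompletion K) ^ 3) :
    ∃ Q : (W.baseChange (v.adicCompletion K)).toAffine.Point,
      p • Q = WeierstrassCurve.Affine.Point.baseChange (W' := W) K (v.adicCompletion K)
        (.some x y h) := by
  have hT : WeierstrassCurve.Affine.Point.baseChange (W' := W) K (v.adicCompletion K) (.some x y h) ∈
      kernel (NormedField.valuation : Valuation (v.adicCompletion K) ℝ≥0)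
        (W.baseChange (v.adicCompletion K)) :=
    (baseChange_some_mem_kernel_iff v W h).mpr hx
  have hTz : (NormedField.valuation : Valuation (v.adicCompletion K) ℝ≥0)
      (WeierstrassCurve.Affine.Point.baseChange (W' := W) K (v.adicCompletion K)
        (.some x y h)).zCoord ≤
      (NormedField.valuation : Valuation (v.adicCompletion K) ℝ≥0) (p : v.adicCompletion K) ^ 3 := by
    rw [zCoord_baseChange]
    change (NormedField.valuation : Valuation (v.adicCompletion K) ℝ≥0)
        (algebraMap K (v.adicCompletion K) (-x / y)) ≤ _
    rw [neg_div, map_neg, Valuation.map_neg]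
    exact hz
  obtain ⟨Q, -, -, hQ⟩ :=
    exists_nsmul_eq_of_mem_kernel_of_val_zCoord_le_cube' v _ hp hpv hT hTz
  exact ⟨Q, hQ⟩

/-- **END (`v ∤ p`): divisibility of a `K`-rational point by `p` in `E(K_v)` from ONE valuation** —
`W` a Weierstrass equation over `K` with `W ⊗ K_v` elliptic and `v`-integral, `p ∉ v`, and
`P = (x, y) ∈ E(K)` with `|x|_v > 1` (i.e. `P|_{K_v}` in the kernel of reduction). Then
`P|_{K_v} = p • Q` for some `Q ∈ E(K_v)`. Use: the first disjunct of `hdiv` at a bad place `v ∤ p`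
of the witness theorem where `E'(K_v)[p] ≠ 0`. [cite: SilvermanAEC2009, Thm. IV.6.4]
[cite: SilvermanAEC2009, Prop. VII.2.2] -/
theorem exists_nsmul_eq_baseChange_of_one_lt_val (W : WeierstrassCurve K)
    [(W.baseChange (v.adicCompletion K)).IsElliptic]
    [(W.baseChange (v.adicCompletion K)).IsIntegral
      ((NormedField.valuation : Valuation (v.adicCompletion K) ℝ≥0)).integer]
    {p : ℕ} (hpv : (p : 𝓞 K) ∉ v.asIdeal) {x y : K} (h : W.toAffine.Nonsingular x y)
    (hx : 1 < (NormedField.valuation : Valuation (v.adicCompletion K) ℝ≥0)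
      (algebraMap K (v.adicCompletion K) x)) :
    ∃ Q : (W.baseChange (v.adicCompletion K)).toAffine.Point,
      p • Q = WeierstrassCurve.Affine.Point.baseChange (W' := W) K (v.adicCompletion K)
        (.some x y h) := by
  have hT : WeierstrassCurve.Affine.Point.baseChange (W' := W) K (v.adicCompletion K) (.some x y h) ∈
      kernel (NormedField.valuation : Valuation (v.adicCompletion K) ℝ≥0)
        (W.baseChange (v.adicCompletion K)) :=
    (baseChange_some_mem_kernel_iff v W h).mpr hx
  obtain ⟨Q, -, -, hQ⟩ := exists_nsmul_eq_of_mem_kernel_of_not_mem' v _ hpv hT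
  exact ⟨Q, hQ⟩

/-- **END (uniform in `v`)**: `W/K` with `W ⊗ K_v` elliptic and `v`-integral, `p` prime,
`P = (x, y) ∈ E(K)` with `|x|_v > 1`, and — only when `p ∈ v` — `|x/y|_v ≤ |p|_v³`. Then
`P|_{K_v} = p • Q` in `E(K_v)`. This is the shape a record quantifies over `v ∈ S`.
[cite: SilvermanAEC2009, Thm. IV.6.4] [cite: SilvermanAEC2009, Prop. VII.2.2] -/
theorem exists_nsmul_eq_baseChange_of_one_lt_val_of_imp (W : WeierstrassCurve K)
    [(W.baseChange (v.adicCompletion K)).IsElliptic]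
    [(W.baseChange (v.adicCompletion K)).IsIntegral
      ((NormedField.valuation : Valuation (v.adicCompletion K) ℝ≥0)).integer]
    {p : ℕ} (hp : p.Prime) {x y : K} (h : W.toAffine.Nonsingular x y)
    (hx : 1 < (NormedField.valuation : Valuation (v.adicCompletion K) ℝ≥0)
      (algebraMap K (v.adicCompletion K) x))
    (hz : (p : 𝓞 K) ∈ v.asIdeal →
      (NormedField.valuation : Valuation (v.adicCompletion K) ℝ≥0)
          (algebraMap K (v.adicCompletion K) (x / y)) ≤
        (NormedField.valuation : Valuation (v.adicCompletion K) ℝ≥0) (p : v.adicCompletion K) ^ 3) :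
    ∃ Q : (W.baseChange (v.adicCompletion K)).toAffine.Point,
      p • Q = WeierstrassCurve.Affine.Point.baseChange (W' := W) K (v.adicCompletion K)
        (.some x y h) := by
  by_cases hpv : (p : 𝓞 K) ∈ v.asIdeal
  · exact exists_nsmul_eq_baseChange_of_one_lt_val_of_val_le v W hp hpv h hx (hz hpv)
  · exact exists_nsmul_eq_baseChange_of_one_lt_val v W hpv h hx

end Summit.BirchSwinnertonDyer.Rank1Residual.GaloisImage.LocalDivisibility

end
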